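import Summits.ResolutionOfSingularities.ResolutionOfSingularities.Theorems.HilbertSamuelEliminationSigmaMaxModificationsCorridor3Directrix214SharpBase
import Mathlib.RingTheory.MvPolynomial.Ideal
import HarnessLib

/-!
# [OURS · L1 W4.2] 2.14♯ — algebraic core, part 2: additive forms in a linear ideal; the core theorem
# `directrixSpace_le_of_generated_by_additive`

Cell res-hironaka, rung L, slot W4.2 (crux `SigmaMaxModificationsCorridor3`, stmt-ResolutionOfSingularities-19249),
typing item T7 (2.14♯). FACT-FREE. Sequel of `…Corridor3Directrix214SharpBase.lean`:

* `addForm_mem_adjoin_of_mem_ideal_span` — an additive form `Σ a_j X_j^{p^e}` lying in an ideal generated by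
  linear forms `T₀` is a polynomial in those linear forms (`∈ k[T₀]`): change coordinates so that `T₀` becomes a
  set of variables (`coordChange_addForm`: additive forms stay additive, Frobenius), then read off the support
  (`addForm_mem_adjoin_X_of_mem_span_X`);
* **`directrixSpace_le_of_generated_by_additive` (THE CORE)** — `k` of characteristic `p`, `G` additive forms,
  `U = k[G]`, `J = (G) · S` (the ideal of the homogeneous additive group `B = V(G)`), `I` an ideal GENERATED
  inside `U` (shape of [H4, Th. IV] read through [H4] p. 170 «invariant ⟺ generated by elements of `U`»); IF
  «`B` not a vector group ⇒ `dim B ≥ 2p − 1`» (Mizutani-shape hypothesis) and `e(I · K[X]) ≤ 2p − 2` for a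
  perfect algebraic `K ⊇ k`, THEN `𝒯(I) ⊆ span_k(J ∩ S_1)`: the directrix space of `I` consists of linear
  forms of `J`; `directrixSpace_le_ideal_span_addForm`: `𝒯(I) ⊆ J`.

[OURS · L1 W4.2]; NOT a statement of any source nor of H. Hironaka's 2017 manuscript. AI-written
(res-type-001); AI review is weaker than expert review.
-/

set_option linter.dupNamespace false

noncomputable section

open MvPolynomial Module
open Literature.RingTheory.MvPolynomial
open Literature.AlgebraicGeometry.Resolution.HironakaScheme

namespace Summit.ResolutionOfSingularities.ResolutionOfSingularities.Theorems.SigmaMaxModificationsCorridor3.Directrix214Sharp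

universe u v

/-! ## Additive forms lying in a LINEAR ideal are polynomials in its linear forms -/

section VectorGroup

variable {k : Type u} [Field k] (p : ℕ) [Fact p.Prime] [CharP k p] {n : ℕ}

omit [Fact p.Prime] [CharP k p] in
/-- Additivity of `addForm` in the coefficient vector. [folklore] -/
theorem addForm_add (e : ℕ) (a b : Fin (n + 1) → k) :
    addForm k p e (a + b) = addForm k p e a + addForm k p e b := by
  simp only [addForm, Pi.add_apply, map_add, add_mul, Finset.sum_add_distrib]

omit [Fact p.Prime] [CharP k p] in
/-- `addForm e (Σ_j v_j) = Σ_j addForm e v_j`. [folklore] -/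
theorem addForm_sum (e : ℕ) {ι : Type*} (s : Finset ι) (v : ι → Fin (n + 1) → k) :
    addForm k p e (∑ j ∈ s, v j) = ∑ j ∈ s, addForm k p e (v j) := by
  classical
  induction s using Finset.induction_on with
  | empty =>
    simp only [Finset.sum_empty, addForm]
    exact Finset.sum_eq_zero fun j _ => by simp
  | insert j s hj ih => rw [Finset.sum_insert hj, Finset.sum_insert hj, addForm_add, ih]

omit [CharP k p] in
/-- The coefficient of `X_l^{p^e}` in `Σ_j a_j X_j^{p^e}` is `a_l`. [folklore] -/
theorem coeff_addForm (e : ℕ) (a : Fin (n + 1) → k) (l : Fin (n + 1)) :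
    coeff (Finsupp.single l (p ^ e)) (addForm k p e a) = a l := by
  classical
  simp only [addForm, coeff_sum, coeff_C_mul, coeff_X_pow]
  have hq : (p ^ e : ℕ) ≠ 0 := pow_ne_zero e (Fact.out : p.Prime).ne_zero
  have key : ∀ j : Fin (n + 1), (a j * if Finsupp.single j (p ^ e) = Finsupp.single l (p ^ e) then 1 else 0)
      = if j = l then a j else 0 := by
    intro j
    by_cases hjl : j = l
    · subst hjl; simp
    · rw [if_neg hjl, if_neg (fun h => hjl ((Finsupp.single_left_inj hq).mp h)), mul_zero]
  simp_rw [key]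
  rw [Finset.sum_ite_eq' Finset.univ l a, if_pos (Finset.mem_univ l)]

omit [CharP k p] in
/-- An additive form lying in the ideal of the coordinate subspace `(X_j : j ∈ J₁)` only involves the
variables of `J₁`. [folklore] -/
theorem addForm_mem_adjoin_X_of_mem_span_X (e : ℕ) (a : Fin (n + 1) → k) (J₁ : Finset (Fin (n + 1)))
    (h : addForm k p e a ∈ Ideal.span (MvPolynomial.X '' (J₁ : Set (Fin (n + 1))) :
      Set (MvPolynomial (Fin (n + 1)) k))) :
    addForm k p e a ∈ Algebra.adjoin k (MvPolynomial.X '' (J₁ : Set (Fin (n + 1))) :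
      Set (MvPolynomial (Fin (n + 1)) k)) := by
  classical
  rw [MvPolynomial.mem_ideal_span_X_image] at h
  have hzero : ∀ l : Fin (n + 1), l ∉ J₁ → a l = 0 := by
    intro l hl
    by_contra hal
    have hsupp : Finsupp.single l (p ^ e) ∈ (addForm k p e a).support := by
      rw [MvPolynomial.mem_support_iff, coeff_addForm]
      exact hal
    obtain ⟨i, hi, hne⟩ := h _ hsupp
    rw [Finsupp.single_apply] at hne
    by_cases hli : l = i
    · exact hl (hli ▸ hi)
    · exact hne (if_neg hli)
  unfold addForm
  refine Subalgebra.sum_mem _ fun l _ => ?_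
  by_cases hl : l ∈ J₁
  · have hC : (C (a l) : MvPolynomial (Fin (n + 1)) k) ∈ Algebra.adjoin k (MvPolynomial.X '' (J₁ : Set (Fin (n + 1))) :
        Set (MvPolynomial (Fin (n + 1)) k)) := by
      rw [← MvPolynomial.algebraMap_eq]
      exact Subalgebra.algebraMap_mem _ _
    have hX : (X l : MvPolynomial (Fin (n + 1)) k) ∈ Algebra.adjoin k (MvPolynomial.X '' (J₁ : Set (Fin (n + 1))) :
        Set (MvPolynomial (Fin (n + 1)) k)) :=
      Algebra.subset_adjoin (Set.mem_image_of_mem MvPolynomial.X (Finset.mem_coe.mpr hl))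
    exact Subalgebra.mul_mem _ hC (Subalgebra.pow_mem _ hX _)
  · rw [hzero l hl, map_zero, zero_mul]
    exact Subalgebra.zero_mem _

/-- A linear change of coordinates `θ` maps the additive form `Σ a_j X_j^{p^e}` to the additive form with
coefficient vector `Σ_j a_j · F^e(c_j)`, `θ(X_j) = Σ_l c_{jl} X_l` (Frobenius: `(Σ c_l X_l)^{p^e} =
Σ c_l^{p^e} X_l^{p^e}`). [folklore] -/
theorem coordChange_addForm (b : Basis (Fin (n + 1)) k (Fin (n + 1) → k)) (e : ℕ) (a : Fin (n + 1) → k) :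
    coordChangeEquiv b (addForm k p e a) =
      addForm k p e (∑ j, a j • frobVec k p e (⇑(b.repr (Pi.single j 1)))) := by
  rw [addForm_sum]
  conv_lhs => rw [addForm, map_sum]
  refine Finset.sum_congr rfl fun j _ => ?_
  rw [map_mul, map_pow, coordChangeEquiv_apply, coordChangeEquiv_apply, coordChange, MvPolynomial.aeval_C,
    MvPolynomial.aeval_X, MvPolynomial.algebraMap_eq, ← addForm_zero_eq_linForm (p := p), ← addForm_frobVec,
    ← addForm_mul_left]
  rfl

/-- **An additive form lying in an ideal generated by linear forms is a polynomial in those linear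
forms** (for `T₀ ⊆ S_1`: `Σ a_j X_j^{p^e} ∈ (T₀) · S ⟹ Σ a_j X_j^{p^e} ∈ k[T₀]`). [folklore] -/
theorem addForm_mem_adjoin_of_mem_ideal_span (T₀ : Submodule k (MvPolynomial (Fin (n + 1)) k))
    (hT₀ : T₀ ≤ homogeneousSubmodule (Fin (n + 1)) k 1) (e : ℕ) (a : Fin (n + 1) → k)
    (h : addForm k p e a ∈ Ideal.span (T₀ : Set (MvPolynomial (Fin (n + 1)) k))) :
    addForm k p e a ∈ Algebra.adjoin k (T₀ : Set (MvPolynomial (Fin (n + 1)) k)) := by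
  classical
  obtain ⟨b, J₁, -, hJ₁, -⟩ := exists_basis_adapted (T₀.comap linForm) (⊤ : Submodule k (Fin (n + 1) → k))
  have hT' : T₀ = Submodule.span k ((fun j => linForm (K := k) (b j)) '' (J₁ : Set (Fin (n + 1)))) := by
    rw [← map_comap_linForm hT₀, ← hJ₁, Submodule.map_span, Set.image_image]
  set θ := coordChangeEquiv b with hθ
  have hmap : (Ideal.span (T₀ : Set (MvPolynomial (Fin (n + 1)) k))).map (θ : MvPolynomial (Fin (n + 1)) k →+*
      MvPolynomial (Fin (n + 1)) k) = Ideal.span (MvPolynomial.X '' (J₁ : Set (Fin (n + 1)))) := by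
    rw [hT', ideal_span_submodule_span, Ideal.map_span, Set.image_image]
    congr 1
    refine Set.image_congr' fun j => ?_
    exact coordChangeEquiv_linForm_basis b j
  -- `θ` of the form is an additive form in the ideal `(X_j : j ∈ J₁)`
  have hθmem : θ (addForm k p e a) ∈ Ideal.span (MvPolynomial.X '' (J₁ : Set (Fin (n + 1))) :
      Set (MvPolynomial (Fin (n + 1)) k)) := by
    rw [← hmap]
    exact Ideal.mem_map_of_mem _ h
  rw [hθ, coordChange_addForm] at hθmem
  have hadj := addForm_mem_adjoin_X_of_mem_span_X p _ _ J₁ hθmem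
  rw [← coordChange_addForm, ← hθ] at hadj
  -- pull back along `θ⁻¹`: `θ⁻¹ (X_j) = linForm (b j) ∈ T₀`
  have hback : addForm k p e a ∈ (Algebra.adjoin k (MvPolynomial.X '' (J₁ : Set (Fin (n + 1))) :
      Set (MvPolynomial (Fin (n + 1)) k))).map (θ.symm : MvPolynomial (Fin (n + 1)) k →ₐ[k]
        MvPolynomial (Fin (n + 1)) k) := by
    refine ⟨θ (addForm k p e a), hadj, ?_⟩
    exact θ.symm_apply_apply _
  rw [AlgHom.map_adjoin] at hback
  refine Algebra.adjoin_le ?_ hback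
  rintro _ ⟨_, ⟨j, hj, rfl⟩, rfl⟩
  have hsymm : (θ.symm : MvPolynomial (Fin (n + 1)) k →ₐ[k] MvPolynomial (Fin (n + 1)) k) (X j) =
      linForm (b j) := by
    change θ.symm (X j) = linForm (b j)
    rw [AlgEquiv.symm_apply_eq]
    exact (coordChangeEquiv_linForm_basis b j).symm
  rw [hsymm, hT']
  refine Algebra.subset_adjoin (Submodule.subset_span ?_)
  exact ⟨j, Finset.mem_coe.mpr hj, rfl⟩

end VectorGroup

/-! ## The core theorem -/

section Core

variable {k : Type u} [Field k] (p : ℕ) [Fact p.Prime] [CharP k p] {n : ℕ}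
variable (K : Type v) [Field K] [Algebra k K] [CharP K p] [PerfectRing K p] [Algebra.IsIntegral k K]

/-- **[OURS · L1 W4.2] The algebraic core of 2.14♯ (crux-chain w42 RULING v3.8-D (D-1)).** Let `k` be a field
of characteristic `p > 0`, `S = k[X_0, …, X_n]`, `G` a family of additive forms `Σ_j a_j X_j^{p^e}`
(`addForm`), `U = k[G]` the algebra they generate and `J = (G) · S` (the ideal of the homogeneous additive
group `B = V(G) = Spec S/J`). Let `I ⊆ S` be an ideal GENERATED by elements of `U` (the shape of the
conclusion of [H4, Thm IV] read through [H4] p. 170: «invariant by `B` ⟺ generated by elements of `U`»).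
Assume the MIZUTANI-SHAPE bound «if `B` is not a vector group (`J` not generated by its linear forms) then
`dim B ≥ 2p − 1`» and `ē := e(I · K[X]) ≤ 2p − 2` for a perfect algebraic extension `K/k`. Then the
directrix space of `I` consists of linear forms of `J`: **`𝒯(I) ⊆ J ∩ S_1`** — the cone `V(I)` is
directed by linear forms vanishing on `B`, i.e. `B_red ⊆ B ⊆ Dir(V(I))` read projectively: every point
of `ℙ(B)` lies on `ℙ(Dir)`. Proof: `dim B ≤ ē` (SHARPENING 1) `≤ 2p − 2 < 2p − 1`, so `B` is a vector group,
`J = (T₀)` with `T₀ = J ∩ S_1`; every additive generator lies in `k[T₀]`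
(`addForm_mem_adjoin_of_mem_ideal_span`), so `T₀` directs `I` and `𝒯(I) ⊆ T₀` (CJS Lemma 2.7, tree
`directrixSpace_le`). No statement of H. Hironaka's 2017 manuscript is involved; NOT a statement of any
source ([OURS] combination of [H4]/[H5]/[Miz]-shaped hypotheses). AI-written; weaker than expert review. -/
theorem directrixSpace_le_of_generated_by_additive
    (A : Set (ℕ × (Fin (n + 1) → k))) (I : Ideal (MvPolynomial (Fin (n + 1)) k))
    (hI : I ≤ Ideal.span ((I : Set (MvPolynomial (Fin (n + 1)) k)) ∩
      (Algebra.adjoin k (addFormOf p '' A) : Set (MvPolynomial (Fin (n + 1)) k))))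
    (hMiz : Ideal.span (addFormOf p '' A) ≠ Ideal.span ((Ideal.span (addFormOf p '' A) :
        Set (MvPolynomial (Fin (n + 1)) k)) ∩ (homogeneousSubmodule (Fin (n + 1)) k 1 :
        Set (MvPolynomial (Fin (n + 1)) k))) →
      (2 * p : WithBot ℕ∞) ≤ ringKrullDim (MvPolynomial (Fin (n + 1)) k ⧸ Ideal.span (addFormOf p '' A)) + 1)
    (hdir : directrixDim (I.map (MvPolynomial.map (algebraMap k K))) + 2 ≤ 2 * p) :
    directrixSpace I ≤ Submodule.span k ((Ideal.span (addFormOf p '' A) :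
        Set (MvPolynomial (Fin (n + 1)) k)) ∩ (homogeneousSubmodule (Fin (n + 1)) k 1 :
        Set (MvPolynomial (Fin (n + 1)) k))) := by
  set G : Set (MvPolynomial (Fin (n + 1)) k) := addFormOf p '' A with hG
  set J : Ideal (MvPolynomial (Fin (n + 1)) k) := Ideal.span G with hJ
  set S₁ : Submodule k (MvPolynomial (Fin (n + 1)) k) := homogeneousSubmodule (Fin (n + 1)) k 1 with hS₁
  -- SHARPENING 1: `dim B ≤ ē`
  have hdim : ringKrullDim (MvPolynomial (Fin (n + 1)) k ⧸ J) ≤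
      (directrixDim (I.map (MvPolynomial.map (algebraMap k K))) : WithBot ℕ∞) :=
    ringKrullDim_quotient_span_addForm_le_directrixDim p A I hI
  -- hence `B` is a vector group
  have hvec : J = Ideal.span ((J : Set (MvPolynomial (Fin (n + 1)) k)) ∩ (S₁ : Set (MvPolynomial (Fin (n + 1)) k))) := by
    by_contra hne
    have h2 := hMiz hne
    have h3 : (2 * p : WithBot ℕ∞) ≤ (directrixDim (I.map (MvPolynomial.map (algebraMap k K))) : WithBot ℕ∞) + 1 :=
      h2.trans (add_le_add hdim le_rfl)
    have h4 : 2 * p ≤ directrixDim (I.map (MvPolynomial.map (algebraMap k K))) + 1 := by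
      exact_mod_cast h3
    omega
  -- the linear forms of `J`
  set T₀ : Submodule k (MvPolynomial (Fin (n + 1)) k) :=
    Submodule.span k ((J : Set (MvPolynomial (Fin (n + 1)) k)) ∩ (S₁ : Set (MvPolynomial (Fin (n + 1)) k))) with hT₀
  have hT₀1 : T₀ ≤ S₁ := Submodule.span_le.mpr fun f hf => hf.2
  have hJT₀ : J = Ideal.span (T₀ : Set (MvPolynomial (Fin (n + 1)) k)) := by
    rw [hT₀, ideal_span_submodule_span]; exact hvec
  -- every additive generator is a polynomial in `T₀`
  have hGT₀ : G ⊆ (Algebra.adjoin k (T₀ : Set (MvPolynomial (Fin (n + 1)) k)) : Set (MvPolynomial (Fin (n + 1)) k)) := by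
    rintro _ ⟨ea, hea, rfl⟩
    refine addForm_mem_adjoin_of_mem_ideal_span p T₀ hT₀1 ea.1 ea.2 ?_
    rw [← hJT₀]
    exact Ideal.subset_span ⟨ea, hea, rfl⟩
  -- so `T₀` directs `I`
  have hdirects : Directs I T₀ := by
    refine ⟨hT₀1, hI.trans (Ideal.span_mono ?_)⟩
    rintro f ⟨hfI, hfG⟩
    exact ⟨hfI, Algebra.adjoin_le hGT₀ hfG⟩
  exact directrixSpace_le hdirects

/-- Corollary: under the same hypotheses every linear form of the directrix space of `I` lies in `J`
(⊆ the homogeneous prime of the point when `J ⊆ 𝔭`: «`x′ ∈ ℙ(Dir(C))`»). [OURS · L1 W4.2; AI-written] -/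
theorem directrixSpace_le_ideal_span_addForm
    (A : Set (ℕ × (Fin (n + 1) → k))) (I : Ideal (MvPolynomial (Fin (n + 1)) k))
    (hI : I ≤ Ideal.span ((I : Set (MvPolynomial (Fin (n + 1)) k)) ∩
      (Algebra.adjoin k (addFormOf p '' A) : Set (MvPolynomial (Fin (n + 1)) k))))
    (hMiz : Ideal.span (addFormOf p '' A) ≠ Ideal.span ((Ideal.span (addFormOf p '' A) :
        Set (MvPolynomial (Fin (n + 1)) k)) ∩ (homogeneousSubmodule (Fin (n + 1)) k 1 :
        Set (MvPolynomial (Fin (n + 1)) k))) →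
      (2 * p : WithBot ℕ∞) ≤ ringKrullDim (MvPolynomial (Fin (n + 1)) k ⧸ Ideal.span (addFormOf p '' A)) + 1)
    (hdir : directrixDim (I.map (MvPolynomial.map (algebraMap k K))) + 2 ≤ 2 * p)
    {f : MvPolynomial (Fin (n + 1)) k} (hf : f ∈ directrixSpace I) :
    f ∈ Ideal.span (addFormOf p '' A) := by
  have h := directrixSpace_le_of_generated_by_additive p K A I hI hMiz hdir hf
  have hle : Submodule.span k ((Ideal.span (addFormOf p '' A) : Set (MvPolynomial (Fin (n + 1)) k)) ∩
      (homogeneousSubmodule (Fin (n + 1)) k 1 : Set (MvPolynomial (Fin (n + 1)) k))) ≤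
      (Ideal.span (addFormOf p '' A)).restrictScalars k :=
    Submodule.span_le.mpr fun g hg => hg.1
  exact hle h

end Core




end Summit.ResolutionOfSingularities.ResolutionOfSingularities.Theorems.SigmaMaxModificationsCorridor3.Directrix214Sharp

end
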